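import Literature.GroupTheory.SpecificGroups.PadicQuadraticAffineGroup
import HarnessLib

/-!
# The real line `U_ℝ ⊂ U` and the level subgroup `πR ⋊ (U_ℝ × U)` of the quadratic `p`-adic affine carrier

Topic `Literature/GroupTheory/SpecificGroups`; continues `PadicQuadraticOneUnits.lean` / `PadicQuadraticAffineGroup.lean`
(`R = ℤ_p[√p]`, `U = 1 + πR`, `G = R ⋊ (U_ℝ × U)`, `aug`, `act`, `stab`):

* `PadicQuadOneUnits.real p` — the REAL principal units `U_ℝ = U ∩ ℤ_p = {im = 0}`: a closed subgroup which is
  infinite (`realPow k = 1 + pᵏ⁺¹`, pairwise distinct) and NOT open (`imPow k = 1 + pᵏ π → 1` off it) — a closed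
  subgroup of infinite index, which the rank-one group `1 + pℤ_p` does not possess; `U` is infinite;
* `PadicQuadAffine.norm_lin_re(_sub_one_lt)` — the linear part `w u` is a principal unit; `continuous_act_re/im`,
  `isClosed_stab` — stabilisers are closed (hence compact);
* `PadicQuadAffine.piLevel p` — the subgroup `πR ⋊ (U_ℝ × U) = {(a, w, u) : a ∈ πR}` (index `p`): closed, NORMAL
  (`(h g h⁻¹).a = (1 − lin g)·a_h + lin h·a_g`), containing every stabiliser (`g · y = y ⇒ a = (1 − lin g) y ∈ πR`)
  and mapping onto `U` under `aug`.  The points `0` and `1` lie in different `piLevel`-orbits.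

(Elementary computations — OUR kernel check, no published claim asserted; the `[cite: …]` tags locate the
DEFINITIONS instantiated: [SemiAnbd] §5 Def 5.3 p. 65.)  Purpose (cell abc-iut, layer L3, row «NV-T54-RESIDUAL
stage 1», design credit abc-iut-w4-d029 gen 6 HANDOFF #2): `U_ℝ` is the kernel of the outer action and `piLevel`
the vertex group of the joint non-vacuity witness
`Literature/AnabelianGeometry/SemiGraphs/ArithTotalEstrangementTransportWitness.lean` for the hypotheses of
[SemiAnbd] Thm 5.4.  Mathlib only; no statement of any IUT paper is touched; no side taken on [IUTchIII] Cor 3.12.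
-/

noncomputable section

namespace Literature.GroupTheory.SpecificGroups

open Topology Filter Set
open scoped QuadraticAlgebra

variable (p : ℕ) [Fact p.Prime]

namespace PadicQuadOneUnits

variable {p}

variable (p) in
/-- The REAL principal units `U_ℝ = U ∩ ℤ_p = {im = 0}`. [cite: MochizukiSemiAnbd2006, Def 5.3 (i), p. 65] -/
def real : Subgroup (PadicQuadOneUnits p) where
  carrier := {x | x.val.im = 0}
  mul_mem' {x y} hx hy := by
    simp only [mem_setOf_eq, val_mul, QuadraticAlgebra.im_mul] at hx hy ⊢
    simp [hx, hy]
  one_mem' := by simp [QuadraticAlgebra.im_one]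
  inv_mem' {x} hx := by
    simp only [mem_setOf_eq] at hx ⊢
    simp [val_inv, QuadraticAlgebra.algebraMap_eq, hx]

/-- Membership in `U_ℝ`. [cite: MochizukiSemiAnbd2006, Def 5.3 (i), p. 65] -/
@[simp] theorem mem_real_iff (x : PadicQuadOneUnits p) : x ∈ real p ↔ x.val.im = 0 := Iff.rfl

/-- `U_ℝ` is closed. [cite: MochizukiSemiAnbd2006, Def 5.3 (i), p. 65] -/
theorem isClosed_real : IsClosed (real p : Set (PadicQuadOneUnits p)) :=
  isClosed_eq continuous_im continuous_const

/-- The real principal unit `1 + pᵏ⁺¹`. [cite: MochizukiSemiAnbd2006, Def 5.3 (i), p. 65] -/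
def realPow (k : ℕ) : PadicQuadOneUnits p :=
  ⟨⟨1 + (p : ℤ_[p]) ^ (k + 1), 0⟩, by
    simp only [add_sub_cancel_left, norm_pow, PadicInt.norm_p]
    exact pow_lt_one₀ (by positivity)
      (inv_lt_one_of_one_lt₀ (by exact_mod_cast (Fact.out : p.Prime).one_lt)) (by omega)⟩

/-- The non-real principal unit `1 + pᵏ π`. [cite: MochizukiSemiAnbd2006, Def 5.3 (i), p. 65] -/
def imPow (k : ℕ) : PadicQuadOneUnits p := ⟨⟨1, (p : ℤ_[p]) ^ k⟩, by simp⟩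

/-- `realPow k ∈ U_ℝ`, `realPow k ≠ 1`, and the `realPow k` are pairwise distinct; `imPow k ∉ U_ℝ`.
[cite: MochizukiSemiAnbd2006, Def 5.3 (i), p. 65] -/
theorem realPow_mem_real (k : ℕ) : realPow (p := p) k ∈ real p := rfl

/-- `realPow` is injective; in particular `U_ℝ` is infinite. [cite: MochizukiSemiAnbd2006, Def 5.3 (i), p. 65] -/
theorem realPow_injective : Function.Injective (realPow (p := p)) := by
  intro j k h
  have h' := congrArg (fun x => x.val.re) h
  simp only [realPow, add_right_inj] at h'
  have := congrArg PadicInt.valuation h'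
  simpa [PadicInt.valuation_pow] using this

/-- `U_ℝ` is infinite. [cite: MochizukiSemiAnbd2006, Def 5.3 (i), p. 65] -/
theorem real_infinite : (real p : Set (PadicQuadOneUnits p)).Infinite :=
  Set.infinite_of_injective_forall_mem realPow_injective realPow_mem_real

/-- The principal units are infinite. [cite: MochizukiSemiAnbd2006, Def 5.3 (i), p. 65] -/
instance : Infinite (PadicQuadOneUnits p) := Infinite.of_injective _ realPow_injective

/-- `imPow k → 1`. [cite: MochizukiSemiAnbd2006, Def 5.3 (i), p. 65] -/
theorem tendsto_imPow : Tendsto (imPow (p := p)) atTop (𝓝 1) := by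
  rw [isEmbedding_coord.isInducing.nhds_eq_comap, tendsto_comap_iff]
  have e : coord ∘ imPow (p := p) = fun k => ((1 : ℤ_[p]), (p : ℤ_[p]) ^ k) := by funext k; rfl
  rw [e, show coord (1 : PadicQuadOneUnits p) = (1, 0) from rfl]
  refine tendsto_const_nhds.prodMk_nhds ?_
  refine tendsto_pow_atTop_nhds_zero_of_norm_lt_one ?_
  rw [PadicInt.norm_p]
  exact inv_lt_one_of_one_lt₀ (by exact_mod_cast (Fact.out : p.Prime).one_lt)

/-- A subset of `U` containing `1` but no `imPow k` (`k ≥ 1`) is not open; in particular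
**`U_ℝ` is NOT open** and **`{1}` is not open**. [cite: MochizukiSemiAnbd2006, Def 5.3 (i), p. 65] -/
theorem not_isOpen_of_forall_imPow_not_mem {S : Set (PadicQuadOneUnits p)} (h1 : (1 : _) ∈ S)
    (h : ∀ k, 1 ≤ k → imPow k ∉ S) : ¬ IsOpen S := by
  intro hS
  have hev := tendsto_imPow.eventually (hS.mem_nhds h1)
  rw [Filter.eventually_atTop] at hev
  obtain ⟨N, hN⟩ := hev
  exact h (N + 1) (by omega) (hN (N + 1) (by omega))

/-- `imPow k ∉ U_ℝ` for `k`: its imaginary part `pᵏ ≠ 0`. [cite: MochizukiSemiAnbd2006, Def 5.3 (i), p. 65] -/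
theorem imPow_not_mem_real (k : ℕ) : imPow (p := p) k ∉ real p := by
  simp [imPow, pow_ne_zero _ PadicInt.irreducible_p.ne_zero]

/-- **`U_ℝ` is not open in `U`** (a closed subgroup of infinite index of the rank-two group `U`).
[cite: MochizukiSemiAnbd2006, Def 5.3 (i), p. 65] -/
theorem not_isOpen_real : ¬ IsOpen (real p : Set (PadicQuadOneUnits p)) :=
  not_isOpen_of_forall_imPow_not_mem (real p).one_mem fun k _ => imPow_not_mem_real k

end PadicQuadOneUnits

namespace PadicQuadAffine

variable {p}

/-! #### The linear part, closed stabilisers, and the translation-level subgroup `{a ∈ πR}` -/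

/-- The linear part is a principal unit: `‖re (lin g) − 1‖ < 1`. [cite: MochizukiSemiAnbd2006, Def 5.3 (i), p. 65] -/
theorem norm_lin_re_sub_one_lt (g : PadicQuadAffine p) : ‖g.lin.re - 1‖ < 1 :=
  PadicQuad.norm_re_mul_sub_one_lt g.w.2 g.u.2

/-- `‖re (lin g)‖ = 1`. [cite: MochizukiSemiAnbd2006, Def 5.3 (i), p. 65] -/
theorem norm_lin_re (g : PadicQuadAffine p) : ‖g.lin.re‖ = 1 := PadicQuad.norm_re_eq_one g.norm_lin_re_sub_one_lt

/-- `re (g · y)` is continuous in `g`. [cite: MochizukiSemiAnbd2006, Def 5.3 (ii), p. 65] -/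
theorem continuous_act_re (y : PadicQuad p) : Continuous fun g : PadicQuadAffine p => (act g y).re := by
  simp only [act, QuadraticAlgebra.re_add]
  exact (PadicQuad.continuous_re_mul continuous_lin_re continuous_lin_im continuous_const continuous_const).add
    continuous_are

/-- `im (g · y)` is continuous in `g`. [cite: MochizukiSemiAnbd2006, Def 5.3 (ii), p. 65] -/
theorem continuous_act_im (y : PadicQuad p) : Continuous fun g : PadicQuadAffine p => (act g y).im := by
  simp only [act, QuadraticAlgebra.im_add]
  exact (PadicQuad.continuous_im_mul continuous_lin_re continuous_lin_im continuous_const continuous_const).add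
    continuous_aim

/-- Stabilisers are closed (hence compact). [cite: MochizukiSemiAnbd2006, Def 5.3 (ii), p. 65] -/
theorem isClosed_stab (y : PadicQuad p) : IsClosed (stab y : Set (PadicQuadAffine p)) := by
  have e : (stab y : Set (PadicQuadAffine p)) = {g | (act g y).re = y.re} ∩ {g | (act g y).im = y.im} := by
    ext g
    simp only [SetLike.mem_coe, mem_stab_iff, mem_inter_iff, mem_setOf_eq, QuadraticAlgebra.ext_iff]
  rw [e]
  exact (isClosed_eq (continuous_act_re y) continuous_const).inter
    (isClosed_eq (continuous_act_im y) continuous_const)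

/-- Stabilisers are compact. [cite: MochizukiSemiAnbd2006, Def 5.3 (ii), p. 65] -/
theorem isCompact_stab (y : PadicQuad p) : IsCompact (stab y : Set (PadicQuadAffine p)) :=
  (isClosed_stab y).isCompact

variable (p) in
/-- The subgroup `πR ⋊ (U_ℝ × U) = {(a, w, u) : a ∈ πR}` of elements whose translation part lies in the
maximal ideal `πR = {re ≡ 0 (mod p)}` (index `p`; it is the vertex group of the witness, the points `0`
and `1` lying in different orbits of it). [cite: MochizukiSemiAnbd2006, Def 5.3 (ii), p. 65] -/
def piLevel : Subgroup (PadicQuadAffine p) where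
  carrier := {g | ‖g.a.re‖ < 1}
  mul_mem' {g h} hg hh := by
    simp only [mem_setOf_eq, mul_a, QuadraticAlgebra.re_add, QuadraticAlgebra.re_mul] at hg hh ⊢
    refine (PadicInt.nonarchimedean _ _).trans_lt (max_lt hg ((PadicInt.nonarchimedean _ _).trans_lt
      (max_lt ?_ ?_)))
    · rw [norm_mul]
      exact (mul_le_of_le_one_left (norm_nonneg _) (PadicInt.norm_le_one _)).trans_lt hh
    · rw [mul_assoc, norm_mul, PadicInt.norm_p]
      exact (mul_le_of_le_one_right (by positivity) (PadicInt.norm_le_one _)).trans_lt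
        (inv_lt_one_of_one_lt₀ (by exact_mod_cast (Fact.out : p.Prime).one_lt))
  one_mem' := by simp
  inv_mem' {g} hg := by
    simp only [mem_setOf_eq, inv_a, QuadraticAlgebra.re_neg, norm_neg, QuadraticAlgebra.re_mul] at hg ⊢
    refine (PadicInt.nonarchimedean _ _).trans_lt (max_lt ?_ ?_)
    · rw [norm_mul]
      exact (mul_le_of_le_one_left (norm_nonneg _) (PadicInt.norm_le_one _)).trans_lt hg
    · rw [mul_assoc, norm_mul, PadicInt.norm_p]
      exact (mul_le_of_le_one_right (by positivity) (PadicInt.norm_le_one _)).trans_lt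
        (inv_lt_one_of_one_lt₀ (by exact_mod_cast (Fact.out : p.Prime).one_lt))

/-- Membership in `piLevel`. [cite: MochizukiSemiAnbd2006, Def 5.3 (ii), p. 65] -/
@[simp] theorem mem_piLevel_iff (g : PadicQuadAffine p) : g ∈ piLevel p ↔ ‖g.a.re‖ < 1 := Iff.rfl

/-- `piLevel` is closed. [cite: MochizukiSemiAnbd2006, Def 5.3 (ii), p. 65] -/
theorem isClosed_piLevel : IsClosed (piLevel p : Set (PadicQuadAffine p)) := by
  have e : (piLevel p : Set (PadicQuadAffine p)) = (fun g : PadicQuadAffine p => g.a.re + 1) ⁻¹'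
      {s : ℤ_[p] | ‖s - 1‖ < 1} := by
    ext g; simp
  rw [e]
  exact PadicQuadOneUnits.isClosed_norm_sub_one_lt.preimage (continuous_are.add continuous_const)

/-- `piLevel` is compact. [cite: MochizukiSemiAnbd2006, Def 5.3 (ii), p. 65] -/
theorem isCompact_piLevel : IsCompact (piLevel p : Set (PadicQuadAffine p)) := isClosed_piLevel.isCompact

/-- `piLevel` is normal: `(h g h⁻¹).a = (1 − lin g)·a_h + lin h · a_g` has real part in `pℤ_p`.
[cite: MochizukiSemiAnbd2006, Def 5.3 (ii), p. 65] -/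
theorem piLevel_normal : (piLevel p).Normal := by
  constructor
  intro g hg h
  simp only [mem_piLevel_iff] at hg ⊢
  have e : (h * g * h⁻¹).a = (1 - g.lin) * h.a + h.lin * g.a := by
    have := h.lin_mul_lin_inv
    simp only [lin, inv_w, inv_u] at this
    simp only [mul_a, inv_a, mul_w, mul_u, PadicQuadOneUnits.val_mul, lin]
    linear_combination (-(g.w.val * g.u.val) * h.a) * this
  have hp1 : ‖(p : ℤ_[p])‖ < 1 := by
    rw [PadicInt.norm_p]; exact inv_lt_one_of_one_lt₀ (by exact_mod_cast (Fact.out : p.Prime).one_lt)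
  have small_p : ∀ s t : ℤ_[p], ‖(p : ℤ_[p]) * s * t‖ < 1 := fun s t => by
    rw [mul_assoc, norm_mul]
    exact (mul_le_of_le_one_right (norm_nonneg _) (PadicInt.norm_le_one _)).trans_lt hp1
  rw [e, QuadraticAlgebra.re_add, QuadraticAlgebra.re_mul, QuadraticAlgebra.re_mul]
  refine (PadicInt.nonarchimedean _ _).trans_lt (max_lt ((PadicInt.nonarchimedean _ _).trans_lt
    (max_lt ?_ (small_p _ _))) ((PadicInt.nonarchimedean _ _).trans_lt (max_lt ?_ (small_p _ _))))
  · rw [norm_mul, QuadraticAlgebra.re_sub, QuadraticAlgebra.re_one, ← norm_neg, neg_sub]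
    exact (mul_le_of_le_one_right (norm_nonneg _) (PadicInt.norm_le_one _)).trans_lt g.norm_lin_re_sub_one_lt
  · rw [norm_mul]
    exact (mul_le_of_le_one_left (norm_nonneg _) (PadicInt.norm_le_one _)).trans_lt hg

/-- Every stabiliser lies in `piLevel`: `g · y = y` gives `a = (1 − lin g) y`, whose real part
`(1 − re lin g) re y − p (im lin g)(im y)` lies in `pℤ_p`. [cite: MochizukiSemiAnbd2006, Def 5.3 (ii), p. 65] -/
theorem stab_le_piLevel (y : PadicQuad p) : stab y ≤ piLevel p := by
  intro g hg
  simp only [mem_stab_iff, act] at hg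
  simp only [mem_piLevel_iff]
  have e : g.a = (1 - g.lin) * y := by linear_combination hg
  rw [e, QuadraticAlgebra.re_mul, QuadraticAlgebra.re_sub, QuadraticAlgebra.re_one, QuadraticAlgebra.im_sub,
    QuadraticAlgebra.im_one, zero_sub]
  refine (PadicInt.nonarchimedean _ _).trans_lt (max_lt ?_ ?_)
  · rw [norm_mul, ← norm_neg, neg_sub]
    exact (mul_le_of_le_one_right (norm_nonneg _) (PadicInt.norm_le_one _)).trans_lt g.norm_lin_re_sub_one_lt
  · rw [mul_assoc, norm_mul, PadicInt.norm_p]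
    exact (mul_le_of_le_one_right (by positivity) (PadicInt.norm_le_one _)).trans_lt
      (inv_lt_one_of_one_lt₀ (by exact_mod_cast (Fact.out : p.Prime).one_lt))

/-- `ofUnit u ∈ piLevel`. [cite: MochizukiSemiAnbd2006, Def 5.3 (ii), p. 65] -/
@[simp] theorem ofUnit_mem_piLevel (u : PadicQuadOneUnits p) : ofUnit u ∈ piLevel p := by
  simp [ofUnit]

/-- `piLevel` maps ONTO `U` under the augmentation. [cite: MochizukiSemiAnbd2006, Def 5.3 (i), p. 65] -/
theorem map_aug_piLevel : (piLevel p).map aug = ⊤ :=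
  top_le_iff.mp fun u _ => ⟨ofUnit u, ofUnit_mem_piLevel u, rfl⟩

/-- An element of the vertex group moves `1` to a point `≠ 0` (real part a unit plus a non-unit).
[cite: MochizukiSemiAnbd2006, Def 5.3 (ii), p. 65] -/
theorem act_one_ne_zero {g : PadicQuadAffine p} (hg : g ∈ piLevel p) : act g 1 ≠ 0 := by
  intro h
  have hre := congrArg QuadraticAlgebra.re h
  simp only [act, mul_one, QuadraticAlgebra.re_add, QuadraticAlgebra.re_zero] at hre
  have : ‖g.lin.re‖ < 1 := by
    rw [show g.lin.re = -g.a.re by linear_combination hre, norm_neg]; exact hg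
  exact absurd g.norm_lin_re this.ne

/-- An element of the vertex group moves `0` to a point `≠ 1`. [cite: MochizukiSemiAnbd2006, Def 5.3 (ii), p. 65] -/
theorem act_zero_ne_one {g : PadicQuadAffine p} (hg : g ∈ piLevel p) : act g 0 ≠ 1 := by
  intro h
  have hre := congrArg QuadraticAlgebra.re h
  simp only [act, mul_zero, zero_add, QuadraticAlgebra.re_one] at hre
  rw [mem_piLevel_iff, hre] at hg
  simp at hg

end PadicQuadAffine

end Literature.GroupTheory.SpecificGroups
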